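import Summits.Ventures.PercRepro.RankLevelSetRuleQSliceBinom
import Summits.Ventures.PercRepro.RankLevelSetRuleQSliceRho
import Summits.Ventures.PercRepro.RankLevelSetRuleQRhat

/-!
# PercRepro — THE BORDERLINE AT `m = 2` FOR EVERY `k ≥ 11`: `Φ(2k, k) ≤ R̂(k, k, 2)` (night-1, gen 20; dossier §31.11)

The second uniform bottom cell of the conjecture of record §28.7 (the first, `m = 1`, is the lane's §23.8′): in the cell
`(2k, k)` the member with `#(flatPart Z) = 2` (slice `u = k − 2`) is paid by Rule Q's equal split, for every family `k ≥ 11`.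
PROOF — the direct identity of RankLevelSetRuleQSliceBinom at `m = 2` (`phiK_le_rhat_border_of_rho`): it suffices that
`T(k, k) ≤ 1 + ρ(3k, k) − ρ(k+2, 2)`, and with `k = K + 2`:
* `two_tail_ratio` — `C(2K+2, K+2+j)/C(2K+4+j, K+2+j) ≤ ((K+2)/(2K+3))·2^{−(j+1)}` (consecutive ratio `(K−j)/(2K+5+j) ≤ 1/2`);
* `two_a_terms` — the three `a`-terms are at most `(25/9)` times the leading ratio (`(j+1+K)/(2K+5+j) ≤ 2/3`);
* `two_tail_le` — hence `T(k, k) ≤ (25/9)·(K+2)/(2K+3) ≤ (25/9)(11/21) = 1.455…` for `K ≥ 9`;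
* `two_rho_prime` — `ρ(k+2, 2) = 1 + 2(K+5)/((K+3)(K+4)) ≤ 1 + 7/39`;
* `two_rho_lower` — `ρ(3k, k) ≥ 1 + r₁(1 + r₂(1 + r₃(1 + r₄)))`, `r_t = (K+3−t)/(2K+4+t)` (`rho_succ` four times, `rho_ge_one`),
  `≥ 1.7713` for `K ≥ 9`;
* **`border_flat_two`** / **`phiK_le_rhat_flat_two (k) (11 ≤ k) : phiK (2 * k) k ≤ rhat k k 2`**: `1.455 ≤ 1 + 1.771 − 1.18`;
* `ruleQRecv_ge_phiK_flat_two` — the matroid level through `rhat_le_ruleQRecv`.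
The same template (the exact identity at fixed `m`, crude geometric bounds on the tail, a few terms of `ρ`) is the plan for every
bounded `m` (proofs/NIGHT-1-PLAN-g21.md). Axioms: standard.
-/

namespace PercRepro

open Finset

/-- The leading tail ratio at the cell `(2k, k)`, `k = K + 2`: `C(2K+2, K+2+j)/C(2K+4+j, K+2+j) ≤ ((K+2)/(2K+3))·2^{−(j+1)}`
for `j ≤ K` (the ratio of consecutive terms is `(K−j)/(2K+5+j) ≤ 1/2`). -/
lemma two_tail_ratio (K : ℕ) : ∀ j : ℕ, j ≤ K →
    ((2 * K + 2).choose (K + 2 + j) : ℚ) / ((2 * K + 4 + j).choose (K + 2 + j) : ℚ)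
      ≤ (((K : ℚ) + 2) / (2 * (K : ℚ) + 3)) / 2 ^ (j + 1) := by
  intro j
  induction j with
  | zero =>
    intro _
    have e1 := Nat.choose_mul_succ_eq (2 * K + 2) (K + 2)   -- C(2K+2, K+2)(2K+3) = C(2K+3, K+2)(2K+3−(K+2))
    have e2 := Nat.choose_mul_succ_eq (2 * K + 3) (K + 2)   -- C(2K+3, K+2)(2K+4) = C(2K+4, K+2)(2K+4−(K+2))
    rw [show 2 * K + 2 + 1 - (K + 2) = K + 1 by omega] at e1
    rw [show 2 * K + 3 + 1 - (K + 2) = K + 2 by omega] at e2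
    have e1' : ((2 * K + 2).choose (K + 2) : ℚ) * (2 * (K : ℚ) + 3) = ((2 * K + 3).choose (K + 2) : ℚ) * ((K : ℚ) + 1) := by
      have := congrArg (fun x : ℕ => (x : ℚ)) e1; push_cast at this; linarith [this]
    have e2' : ((2 * K + 3).choose (K + 2) : ℚ) * (2 * (K : ℚ) + 4) = ((2 * K + 4).choose (K + 2) : ℚ) * ((K : ℚ) + 2) := by
      have := congrArg (fun x : ℕ => (x : ℚ)) e2; push_cast at this; linarith [this]
    have hC : (0 : ℚ) < ((2 * K + 4).choose (K + 2) : ℚ) := by exact_mod_cast Nat.choose_pos (by omega)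
    have hC3 : (0 : ℚ) < ((2 * K + 3).choose (K + 2) : ℚ) := by exact_mod_cast Nat.choose_pos (by omega)
    simp only [Nat.add_zero, zero_add, pow_one]
    rw [div_le_div_iff₀ hC (by positivity), div_mul_eq_mul_div, le_div_iff₀ (by positivity)]
    -- C(2K+2,K+2)·(2K+3)(2K+4) = C(2K+4,K+2)(K+1)(K+2); want C(2K+2,K+2)(2K+3)·2 ≤ (K+2) C(2K+4,K+2)
    have key : ((2 * K + 2).choose (K + 2) : ℚ) * ((2 * (K : ℚ) + 3) * (2 * (K : ℚ) + 4))
        = ((2 * K + 4).choose (K + 2) : ℚ) * (((K : ℚ) + 1) * ((K : ℚ) + 2)) := by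
      nlinarith [e1', e2']
    nlinarith [key, hC, hC3]
  | succ j ih =>
    intro hj
    have ih' := ih (by omega)
    have hA : ((2 * K + 2).choose (K + 2 + (j + 1)) : ℚ) * ((K : ℚ) + 3 + j)
        = ((2 * K + 2).choose (K + 2 + j) : ℚ) * ((K : ℚ) - j) := by
      have := Nat.choose_succ_right_eq (2 * K + 2) (K + 2 + j)   -- C(n, r+1)(r+1) = C(n, r)(n − r)
      rw [show 2 * K + 2 - (K + 2 + j) = K - j by omega] at this
      have hc := congrArg (fun x : ℕ => (x : ℚ)) this
      simp only [Nat.cast_mul, Nat.cast_add, Nat.cast_one, Nat.cast_ofNat, Nat.cast_sub (by omega : j ≤ K)] at hc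
      rw [show K + 2 + (j + 1) = K + 2 + j + 1 by ring]; linarith [hc]
    have hB : ((2 * K + 4 + (j + 1)).choose (K + 2 + (j + 1)) : ℚ) * ((K : ℚ) + 3 + j)
        = ((2 * K + 4 + j).choose (K + 2 + j) : ℚ) * (2 * (K : ℚ) + 5 + j) := by
      have := Nat.add_one_mul_choose_eq (2 * K + 4 + j) (K + 2 + j)   -- (n+1) C(n, r) = C(n+1, r+1)(r+1)
      have hc := congrArg (fun x : ℕ => (x : ℚ)) this
      push_cast at hc
      rw [show 2 * K + 4 + (j + 1) = 2 * K + 4 + j + 1 by ring, show K + 2 + (j + 1) = K + 2 + j + 1 by ring]; linarith [hc]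
    have hC : (0 : ℚ) < ((2 * K + 4 + j).choose (K + 2 + j) : ℚ) := Nat.cast_pos.mpr (Nat.choose_pos (by omega))
    have hC' : (0 : ℚ) < ((2 * K + 4 + (j + 1)).choose (K + 2 + (j + 1)) : ℚ) := Nat.cast_pos.mpr (Nat.choose_pos (by omega))
    have hkj : (0 : ℚ) < (K : ℚ) + 3 + j := by positivity
    have hjK : (j : ℚ) + 1 ≤ K := by exact_mod_cast hj
    have hstep : ((2 * K + 2).choose (K + 2 + (j + 1)) : ℚ) / ((2 * K + 4 + (j + 1)).choose (K + 2 + (j + 1)) : ℚ)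
        ≤ (((2 * K + 2).choose (K + 2 + j) : ℚ) / ((2 * K + 4 + j).choose (K + 2 + j) : ℚ)) / 2 := by
      rw [div_div, div_le_div_iff₀ hC' (by positivity)]
      have h0 : (0 : ℚ) ≤ ((2 * K + 2).choose (K + 2 + j) : ℚ) := by positivity
      -- from hA, hB: new·(K+3+j) = old·(K−j); newC·(K+3+j) = oldC·(2K+5+j); want new·(oldC·2) ≤ old·newC
      -- multiply the goal by (K+3+j)² > 0
      have hmul : (((2 * K + 2).choose (K + 2 + (j + 1)) : ℚ) * (((2 * K + 4 + j).choose (K + 2 + j) : ℚ) * 2)) * (((K : ℚ) + 3 + j) * ((K : ℚ) + 3 + j))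
          ≤ (((2 * K + 2).choose (K + 2 + j) : ℚ) * ((2 * K + 4 + (j + 1)).choose (K + 2 + (j + 1)) : ℚ)) * (((K : ℚ) + 3 + j) * ((K : ℚ) + 3 + j)) := by
        have eL : (((2 * K + 2).choose (K + 2 + (j + 1)) : ℚ) * (((2 * K + 4 + j).choose (K + 2 + j) : ℚ) * 2)) * (((K : ℚ) + 3 + j) * ((K : ℚ) + 3 + j))
            = (((2 * K + 2).choose (K + 2 + j) : ℚ) * ((K : ℚ) - j)) * (((2 * K + 4 + j).choose (K + 2 + j) : ℚ) * 2) * ((K : ℚ) + 3 + j) := by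
          rw [← hA]; ring
        have eR : (((2 * K + 2).choose (K + 2 + j) : ℚ) * ((2 * K + 4 + (j + 1)).choose (K + 2 + (j + 1)) : ℚ)) * (((K : ℚ) + 3 + j) * ((K : ℚ) + 3 + j))
            = ((2 * K + 2).choose (K + 2 + j) : ℚ) * (((2 * K + 4 + j).choose (K + 2 + j) : ℚ) * (2 * (K : ℚ) + 5 + j)) * ((K : ℚ) + 3 + j) := by
          rw [← hB]; ring
        rw [eL, eR]
        have : (K : ℚ) - j ≤ (2 * (K : ℚ) + 5 + j) / 2 := by linarith
        have hh : ((K : ℚ) - j) * 2 ≤ 2 * (K : ℚ) + 5 + j := by linarith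
        have hP : (0 : ℚ) ≤ ((2 * K + 2).choose (K + 2 + j) : ℚ) * ((2 * K + 4 + j).choose (K + 2 + j) : ℚ) * ((K : ℚ) + 3 + j) := by positivity
        nlinarith [mul_le_mul_of_nonneg_left hh hP]
      exact le_of_mul_le_mul_right hmul (by positivity)
    calc _ ≤ (((2 * K + 2).choose (K + 2 + j) : ℚ) / ((2 * K + 4 + j).choose (K + 2 + j) : ℚ)) / 2 := hstep
      _ ≤ ((((K : ℚ) + 2) / (2 * (K : ℚ) + 3)) / 2 ^ (j + 1)) / 2 := by gcongr
      _ = (((K : ℚ) + 2) / (2 * (K : ℚ) + 3)) / 2 ^ (j + 1 + 1) := by rw [pow_succ]; ring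


/-- `Σ_{j<n} (1/2)^{j+1} = 1 − (1/2)^n`. -/
lemma two_half_geom (n : ℕ) : ∑ j ∈ range n, ((1 : ℚ) / 2) ^ (j + 1) = 1 - ((1 : ℚ) / 2) ^ n := by
  induction n with
  | zero => simp
  | succ n ih => rw [Finset.sum_range_succ, ih]; ring

/-- The three `a`-terms at `m = 2`: `Σ_{a<3} C(2,a)/C(2K+4+j+a, K+2+j+a) ≤ (25/9)/C(2K+4+j, K+2+j)` (`j ≤ K`). -/
lemma two_a_terms (K j : ℕ) (hj : j ≤ K) :
    ∑ a ∈ range (2 + 1), ((2 : ℕ).choose a : ℚ) / ((2 + K + (K + 2 + j) + a).choose (a + (K + 2 + j)) : ℚ)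
      ≤ (25 / 9) / ((2 * K + 4 + j).choose (K + 2 + j) : ℚ) := by
  simp only [Finset.sum_range_succ, Finset.sum_range_zero, zero_add, Nat.add_zero,
    show 2 + K + (K + 2 + j) = 2 * K + 4 + j by omega,
    show 1 + (K + 2 + j) = K + 2 + j + 1 by omega,
    show 2 * K + 4 + j + 2 = 2 * K + 4 + j + 1 + 1 by omega,
    show 2 + (K + 2 + j) = K + 2 + j + 1 + 1 by omega]
  have hC0 : (0 : ℚ) < ((2 * K + 4 + j).choose (K + 2 + j) : ℚ) := Nat.cast_pos.mpr (Nat.choose_pos (by omega))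
  have hC1 : (0 : ℚ) < ((2 * K + 4 + j + 1).choose (K + 2 + j + 1) : ℚ) := Nat.cast_pos.mpr (Nat.choose_pos (by omega))
  have hC2 : (0 : ℚ) < ((2 * K + 4 + j + 1 + 1).choose (K + 2 + j + 1 + 1) : ℚ) := Nat.cast_pos.mpr (Nat.choose_pos (by omega))
  -- C(n+1, r+1)(r+1) = (n+1) C(n, r)
  have s1 : ((2 * K + 4 + j + 1).choose (K + 2 + j + 1) : ℚ) * ((K : ℚ) + 2 + j + 1) = (2 * (K : ℚ) + 4 + j + 1) * ((2 * K + 4 + j).choose (K + 2 + j) : ℚ) := by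
    have := congrArg (fun x : ℕ => (x : ℚ)) (Nat.add_one_mul_choose_eq (2 * K + 4 + j) (K + 2 + j)); push_cast at this; linarith [this]
  have s2 : ((2 * K + 4 + j + 1 + 1).choose (K + 2 + j + 1 + 1) : ℚ) * ((K : ℚ) + 2 + j + 1 + 1) = (2 * (K : ℚ) + 4 + j + 1 + 1) * ((2 * K + 4 + j + 1).choose (K + 2 + j + 1) : ℚ) := by
    have := congrArg (fun x : ℕ => (x : ℚ)) (Nat.add_one_mul_choose_eq (2 * K + 4 + j + 1) (K + 2 + j + 1)); push_cast at this; linarith [this]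
  have hjK : (j : ℚ) ≤ K := by exact_mod_cast hj
  -- 3 C0 ≤ 2 C1 and 3 C1 ≤ 2 C2 (the ratios (2K+5+j)/(K+3+j), (2K+6+j)/(K+4+j) are ≥ 3/2 for j ≤ K)
  have hp1 : (0 : ℚ) < (K : ℚ) + 2 + j + 1 := by positivity
  have hp2 : (0 : ℚ) < (K : ℚ) + 2 + j + 1 + 1 := by positivity
  have c1 : 3 * ((2 * K + 4 + j).choose (K + 2 + j) : ℚ) ≤ 2 * ((2 * K + 4 + j + 1).choose (K + 2 + j + 1) : ℚ) := by
    have h : 3 * ((2 * K + 4 + j).choose (K + 2 + j) : ℚ) * ((K : ℚ) + 2 + j + 1)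
        ≤ 2 * ((2 * K + 4 + j + 1).choose (K + 2 + j + 1) : ℚ) * ((K : ℚ) + 2 + j + 1) := by
      nlinarith [s1, hC0, hjK]
    exact le_of_mul_le_mul_right h hp1
  have c2 : 3 * ((2 * K + 4 + j + 1).choose (K + 2 + j + 1) : ℚ) ≤ 2 * ((2 * K + 4 + j + 1 + 1).choose (K + 2 + j + 1 + 1) : ℚ) := by
    have h : 3 * ((2 * K + 4 + j + 1).choose (K + 2 + j + 1) : ℚ) * ((K : ℚ) + 2 + j + 1 + 1)
        ≤ 2 * ((2 * K + 4 + j + 1 + 1).choose (K + 2 + j + 1 + 1) : ℚ) * ((K : ℚ) + 2 + j + 1 + 1) := by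
      nlinarith [s2, hC1, hjK]
    exact le_of_mul_le_mul_right h hp2
  have b1 : (1 : ℚ) / ((2 * K + 4 + j + 1).choose (K + 2 + j + 1) : ℚ) ≤ (2 / 3) / ((2 * K + 4 + j).choose (K + 2 + j) : ℚ) := by
    rw [div_le_div_iff₀ hC1 hC0]; linarith [c1]
  have b2 : (1 : ℚ) / ((2 * K + 4 + j + 1 + 1).choose (K + 2 + j + 1 + 1) : ℚ) ≤ (4 / 9) / ((2 * K + 4 + j).choose (K + 2 + j) : ℚ) := by
    rw [div_le_div_iff₀ hC2 hC0]; linarith [c1, c2]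
  simp only [Nat.choose_zero_right, Nat.choose_one_right, Nat.choose_self, Nat.cast_one, Nat.cast_ofNat]
  have h2 : (2 : ℚ) / ((2 * K + 4 + j + 1).choose (K + 2 + j + 1) : ℚ) = 2 * (1 / ((2 * K + 4 + j + 1).choose (K + 2 + j + 1) : ℚ)) := by ring
  have e : (25 / 9 : ℚ) / ((2 * K + 4 + j).choose (K + 2 + j) : ℚ)
      = 1 / ((2 * K + 4 + j).choose (K + 2 + j) : ℚ) + 2 * ((2 / 3) / ((2 * K + 4 + j).choose (K + 2 + j) : ℚ))
        + (4 / 9) / ((2 * K + 4 + j).choose (K + 2 + j) : ℚ) := by ring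
  rw [h2, e]
  linarith [mul_le_mul_of_nonneg_left b1 (by norm_num : (0 : ℚ) ≤ 2), b2]

/-- **The tail at `m = 2`**: `T(K+2, K+2) ≤ (25/9)·(K+2)/(2K+3)`. -/
lemma two_tail_le (K : ℕ) :
    ∑ j ∈ range (K + 1), ((2 * K + 2).choose (K + 2 + j) : ℚ)
        * ∑ a ∈ range (2 + 1), ((2 : ℕ).choose a : ℚ) / ((2 + K + (K + 2 + j) + a).choose (a + (K + 2 + j)) : ℚ)
      ≤ (25 / 9) * (((K : ℚ) + 2) / (2 * (K : ℚ) + 3)) := by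
  have hterm : ∀ j ∈ range (K + 1), ((2 * K + 2).choose (K + 2 + j) : ℚ)
        * ∑ a ∈ range (2 + 1), ((2 : ℕ).choose a : ℚ) / ((2 + K + (K + 2 + j) + a).choose (a + (K + 2 + j)) : ℚ)
      ≤ (25 / 9) * (((K : ℚ) + 2) / (2 * (K : ℚ) + 3)) * ((1 : ℚ) / 2) ^ (j + 1) := by
    intro j hj
    rw [Finset.mem_range] at hj
    have hA := two_a_terms K j (by omega)
    have hR := two_tail_ratio K j (by omega)
    have hC0 : (0 : ℚ) < ((2 * K + 4 + j).choose (K + 2 + j) : ℚ) := Nat.cast_pos.mpr (Nat.choose_pos (by omega))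
    calc ((2 * K + 2).choose (K + 2 + j) : ℚ)
          * ∑ a ∈ range (2 + 1), ((2 : ℕ).choose a : ℚ) / ((2 + K + (K + 2 + j) + a).choose (a + (K + 2 + j)) : ℚ)
        ≤ ((2 * K + 2).choose (K + 2 + j) : ℚ) * ((25 / 9) / ((2 * K + 4 + j).choose (K + 2 + j) : ℚ)) :=
          mul_le_mul_of_nonneg_left hA (by positivity)
      _ = (25 / 9) * (((2 * K + 2).choose (K + 2 + j) : ℚ) / ((2 * K + 4 + j).choose (K + 2 + j) : ℚ)) := by ring
      _ ≤ (25 / 9) * ((((K : ℚ) + 2) / (2 * (K : ℚ) + 3)) / 2 ^ (j + 1)) := mul_le_mul_of_nonneg_left hR (by norm_num)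
      _ = (25 / 9) * (((K : ℚ) + 2) / (2 * (K : ℚ) + 3)) * ((1 : ℚ) / 2) ^ (j + 1) := by
          rw [one_div_pow]; ring
  calc _ ≤ ∑ j ∈ range (K + 1), (25 / 9) * (((K : ℚ) + 2) / (2 * (K : ℚ) + 3)) * ((1 : ℚ) / 2) ^ (j + 1) :=
        Finset.sum_le_sum hterm
    _ = (25 / 9) * (((K : ℚ) + 2) / (2 * (K : ℚ) + 3)) * ∑ j ∈ range (K + 1), ((1 : ℚ) / 2) ^ (j + 1) := by
        rw [Finset.mul_sum]
    _ ≤ (25 / 9) * (((K : ℚ) + 2) / (2 * (K : ℚ) + 3)) * 1 := by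
        apply mul_le_mul_of_nonneg_left _ (by positivity)
        rw [two_half_geom]
        have : (0 : ℚ) ≤ ((1 : ℚ) / 2) ^ (K + 1) := by positivity
        linarith
    _ = _ := by ring


/-- `ρ(K+4, 2) = 1 + 2(K+5)/((K+3)(K+4))` (the `m = 2` value of `ρ′`). -/
lemma two_rho_prime (K : ℕ) :
    (∑ i ∈ range (2 + 1), ((2 * 2 + K).choose i : ℚ)) / ((2 * 2 + K).choose 2 : ℚ)
      = 1 + 2 * ((K : ℚ) + 5) / (((K : ℚ) + 3) * ((K : ℚ) + 4)) := by
  have h2 : ((2 * 2 + K).choose 2 : ℚ) * 2 = ((K : ℚ) + 4) * ((K : ℚ) + 3) := by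
    have := Nat.add_one_mul_choose_eq (K + 3) 1     -- (K+4) C(K+3, 1) = C(K+4, 2) · 2
    rw [Nat.choose_one_right] at this
    rw [show 2 * 2 + K = K + 3 + 1 by ring]
    have hc := congrArg (fun x : ℕ => (x : ℚ)) this; push_cast at hc; linarith [hc]
  have hC : (0 : ℚ) < ((2 * 2 + K).choose 2 : ℚ) := Nat.cast_pos.mpr (Nat.choose_pos (by omega))
  simp only [Finset.sum_range_succ, Finset.sum_range_zero, zero_add, Nat.choose_zero_right, Nat.choose_one_right, Nat.cast_one]
  rw [div_eq_iff hC.ne']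
  have hK : (0 : ℚ) < ((K : ℚ) + 3) * ((K : ℚ) + 4) := by positivity
  push_cast
  field_simp
  nlinarith [h2]

/-- `ρ(3K+6, K+2) ≥ 1 + r₁ + r₁r₂ + r₁r₂r₃ + r₁r₂r₃r₄` with `r_t = (K+3−t)/(2K+4+t)` (`K ≥ 2`; `rho_succ` four times and
`rho_ge_one`). -/
lemma two_rho_lower (K : ℕ) (hK : 2 ≤ K) :
    1 + ((K : ℚ) + 2) / (2 * (K : ℚ) + 5) * (1 + ((K : ℚ) + 1) / (2 * (K : ℚ) + 6)
      * (1 + (K : ℚ) / (2 * (K : ℚ) + 7) * (1 + ((K : ℚ) - 1) / (2 * (K : ℚ) + 8))))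
      ≤ (∑ i ∈ range (2 + K + 1), ((2 * 2 + 3 * K + 2).choose i : ℚ)) / ((2 * 2 + 3 * K + 2).choose (2 + K) : ℚ) := by
  obtain ⟨L, rfl⟩ : ∃ L, K = L + 2 := ⟨K - 2, by omega⟩
  set n := 2 * 2 + 3 * (L + 2) + 2 with hn
  have h1 := rho_succ n (L + 3) (by omega)
  have h2 := rho_succ n (L + 2) (by omega)
  have h3 := rho_succ n (L + 1) (by omega)
  have h4 := rho_succ n L (by omega)
  have h0 := rho_ge_one n L (by omega)
  rw [show 2 + (L + 2) + 1 = L + 3 + 1 + 1 by ring, show 2 + (L + 2) = L + 3 + 1 by ring, h1]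
  rw [show L + 3 = L + 2 + 1 by ring] at h2 ⊢
  rw [h2]
  rw [show L + 2 = L + 1 + 1 by ring] at h3 ⊢
  rw [h3, h4]
  have hn' : (n : ℚ) = 3 * (L : ℚ) + 12 := by rw [hn]; push_cast; ring
  rw [hn']
  push_cast
  set ρ₀ := (∑ i ∈ range (L + 1), (n.choose i : ℚ)) / (n.choose L : ℚ) with hρ₀
  have e1 : ((L : ℚ) + 1 + 1 + 1 + 1) / (3 * (L : ℚ) + 12 - ((L : ℚ) + 1 + 1 + 1)) = ((L : ℚ) + 2 + 2) / (2 * ((L : ℚ) + 2) + 5) := by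
    congr 1 <;> ring
  have e2 : ((L : ℚ) + 1 + 1 + 1) / (3 * (L : ℚ) + 12 - ((L : ℚ) + 1 + 1)) = ((L : ℚ) + 2 + 1) / (2 * ((L : ℚ) + 2) + 6) := by
    congr 1 <;> ring
  have e3 : ((L : ℚ) + 1 + 1) / (3 * (L : ℚ) + 12 - ((L : ℚ) + 1)) = ((L : ℚ) + 2) / (2 * ((L : ℚ) + 2) + 7) := by
    congr 1 <;> ring
  have e4 : ((L : ℚ) + 1) / (3 * (L : ℚ) + 12 - L) = ((L : ℚ) + 2 - 1) / (2 * ((L : ℚ) + 2) + 8) := by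
    congr 1 <;> ring
  simp only [e1, e2, e3, e4]
  have m4 : (0 : ℚ) ≤ ((L : ℚ) + 2 - 1) / (2 * ((L : ℚ) + 2) + 8) := by
    apply div_nonneg _ (by positivity); linarith [(by positivity : (0 : ℚ) ≤ L)]
  have m3 : (0 : ℚ) ≤ ((L : ℚ) + 2) / (2 * ((L : ℚ) + 2) + 7) := by positivity
  have m2 : (0 : ℚ) ≤ ((L : ℚ) + 2 + 1) / (2 * ((L : ℚ) + 2) + 6) := by positivity
  have m1 : (0 : ℚ) ≤ ((L : ℚ) + 2 + 2) / (2 * ((L : ℚ) + 2) + 5) := by positivity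
  have s4 : ((L : ℚ) + 2 - 1) / (2 * ((L : ℚ) + 2) + 8) ≤ ((L : ℚ) + 2 - 1) / (2 * ((L : ℚ) + 2) + 8) * ρ₀ :=
    le_mul_of_one_le_right m4 h0
  have s3 := mul_le_mul_of_nonneg_left (add_le_add_left s4 1) m3
  have s2 := mul_le_mul_of_nonneg_left (add_le_add_left s3 1) m2
  have s1 := mul_le_mul_of_nonneg_left (add_le_add_left s2 1) m1
  linear_combination s1


/-- **THE BORDERLINE AT `m = 2` FOR EVERY `k = K + 2 ≥ 11`**: `Φ(2k, k) ≤ R̂(k, k, 2)` — the cell `(2k, k)`, the member with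
`#(flatPart Z) = 2` (`u = k − 2`). Written in the forms of `phiK_le_rhat_border_of_rho` (`m = 2`, `k' = K`). -/
theorem border_flat_two (K : ℕ) (hK : 9 ≤ K) :
    phiK (2 + K + (K + 2)) (2 + K) ≤ rhat (2 + K) (K + 2) 2 := by
  refine phiK_le_rhat_border_of_rho 2 K ?_
  have hT := two_tail_le K
  have hρ := two_rho_lower K (by omega)
  have hρ' := two_rho_prime K
  rw [hρ']
  have hK' : (9 : ℚ) ≤ K := by exact_mod_cast hK
  -- the numeric pieces at K ≥ 9
  have t1 : ((K : ℚ) + 2) / (2 * (K : ℚ) + 3) ≤ 11 / 21 := by rw [div_le_div_iff₀ (by positivity) (by positivity)]; linarith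
  have t2 : 2 * ((K : ℚ) + 5) / (((K : ℚ) + 3) * ((K : ℚ) + 4)) ≤ 7 / 39 := by
    rw [div_le_div_iff₀ (by positivity) (by positivity)]; nlinarith
  have a1 : (11 : ℚ) / 23 ≤ ((K : ℚ) + 2) / (2 * (K : ℚ) + 5) := by rw [div_le_div_iff₀ (by positivity) (by positivity)]; linarith
  have a2 : (10 : ℚ) / 24 ≤ ((K : ℚ) + 1) / (2 * (K : ℚ) + 6) := by rw [div_le_div_iff₀ (by positivity) (by positivity)]; linarith
  have a3 : (9 : ℚ) / 25 ≤ (K : ℚ) / (2 * (K : ℚ) + 7) := by rw [div_le_div_iff₀ (by positivity) (by positivity)]; linarith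
  have a4 : (8 : ℚ) / 26 ≤ ((K : ℚ) - 1) / (2 * (K : ℚ) + 8) := by rw [div_le_div_iff₀ (by positivity) (by positivity)]; linarith
  have hS : (11 : ℚ) / 23 * (1 + 10 / 24 * (1 + 9 / 25 * (1 + 8 / 26)))
      ≤ ((K : ℚ) + 2) / (2 * (K : ℚ) + 5) * (1 + ((K : ℚ) + 1) / (2 * (K : ℚ) + 6)
        * (1 + (K : ℚ) / (2 * (K : ℚ) + 7) * (1 + ((K : ℚ) - 1) / (2 * (K : ℚ) + 8)))) := by
    have n4 : (0 : ℚ) ≤ ((K : ℚ) - 1) / (2 * (K : ℚ) + 8) := by apply div_nonneg _ (by positivity); linarith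
    have n3 : (0 : ℚ) ≤ (K : ℚ) / (2 * (K : ℚ) + 7) := by positivity
    have n2 : (0 : ℚ) ≤ ((K : ℚ) + 1) / (2 * (K : ℚ) + 6) := by positivity
    have n1 : (0 : ℚ) ≤ ((K : ℚ) + 2) / (2 * (K : ℚ) + 5) := by positivity
    have u4 : (1 : ℚ) + 8 / 26 ≤ 1 + ((K : ℚ) - 1) / (2 * (K : ℚ) + 8) := by linarith
    have u3 : (9 : ℚ) / 25 * (1 + 8 / 26) ≤ (K : ℚ) / (2 * (K : ℚ) + 7) * (1 + ((K : ℚ) - 1) / (2 * (K : ℚ) + 8)) :=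
      mul_le_mul a3 u4 (by norm_num) n3
    have u2 : (10 : ℚ) / 24 * (1 + 9 / 25 * (1 + 8 / 26))
        ≤ ((K : ℚ) + 1) / (2 * (K : ℚ) + 6) * (1 + (K : ℚ) / (2 * (K : ℚ) + 7) * (1 + ((K : ℚ) - 1) / (2 * (K : ℚ) + 8))) :=
      mul_le_mul a2 (by linarith) (by norm_num) n2
    exact mul_le_mul a1 (by linarith) (by norm_num) n1
  have hTn : ∑ j ∈ range (K + 1), ((2 * K + 2).choose (K + 2 + j) : ℚ)
        * ∑ a ∈ range (2 + 1), ((2 : ℕ).choose a : ℚ) / ((2 + K + (K + 2 + j) + a).choose (a + (K + 2 + j)) : ℚ)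
      ≤ (25 / 9) * (11 / 21) := hT.trans (mul_le_mul_of_nonneg_left t1 (by norm_num))
  have hnum : (25 : ℚ) / 9 * (11 / 21) ≤ 1 + (1 + 11 / 23 * (1 + 10 / 24 * (1 + 9 / 25 * (1 + 8 / 26)))) - (1 + 7 / 39) := by norm_num
  linarith [hTn, hρ, hS, t2, hnum]

/-- **`m = 2`, clean form**: for every `k ≥ 11`, `Φ(2k, k) ≤ R̂(k, k, 2)`. -/
theorem phiK_le_rhat_flat_two (k : ℕ) (hk : 11 ≤ k) : phiK (2 * k) k ≤ rhat k k 2 := by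
  obtain ⟨K, rfl⟩ : ∃ K, k = K + 2 := ⟨k - 2, by omega⟩
  have := border_flat_two K (by omega)
  rw [show 2 + K + (K + 2) = 2 * (K + 2) by ring, show 2 + K = K + 2 by ring] at this
  exact this


/-- The matroid level of `phiK_le_rhat_flat_two`: in every finite matroid at the tight layer of the cell `(2k, k)`, `k ≥ 11`,
every member with `#(flatPart Z) = 2` is paid. -/
theorem ruleQRecv_ge_phiK_flat_two {β : Type} (M : Matroid β) [M.Finite] {k : ℕ} (hk : 11 ≤ k)
    (hE : M.E.ncard = (k + k) + k) {Z : Set β} (hZ : Z ∈ cellMembers M (k + k) k)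
    (hP : (flatPart M Z).ncard = 2) :
    phiK (k + k) k ≤ ruleQRecv M (k + k) k Z := by
  refine le_trans ?_ (rhat_le_ruleQRecv M hE hZ)
  rw [hP, show k + k = 2 * k by ring]
  exact phiK_le_rhat_flat_two k hk

end PercRepro
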